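import Summits.HodgeConjecture.HodgeConjecture.Theses.AmpleAdicLefschetz
import Summits.HodgeConjecture.HodgeConjecture.Theorems.AmpleAdicLefschetzSectionalSourceStubSupply
import Summits.HodgeConjecture.HodgeConjecture.Theorems.AmpleAdicLefschetzSectionalSourceStubLowDegree
import Summits.HodgeConjecture.HodgeConjecture.Theorems.AmpleAdicLefschetzSectionalSourceStubIteratedSupply
import Literature.AlgebraicGeometry.HodgeTheory.MiddleHodgeOfAffineComplementSections
import Literature.AlgebraicGeometry.HodgeTheory.HodgeTypePullback
import Literature.AlgebraicGeometry.HodgeTheory.ComplexConjugationHolds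
import HarnessLib

/-!
# Crux `SectionalSource` (stmt-HodgeConjecture-10725) — CHARACTERISATION: SS ⟺ HC in the middle degree

Crux workfile `Cruxes/SectionalSource/Hardness.lean`, rev 2 (line lead prover-line-stmt-HodgeConjecture-10725-0,
2026-08-17; sorry-free, axioms propext / Classical.choice / Quot.sound). The crux `SectionalSource` (SS) of the
route `AmpleAdicLefschetz` — every rational `(p,p)`-class on a smooth projective `n`-fold `X` with `2p + 1 ≤ n`
becomes algebraic on SOME admissible proper section (`Y` smooth projective, `f : Y ⟶ X` a closed immersion,
`X ∖ f(Y)` non-empty and covered by `≤ n − 2p` affine opens of `X`) — is EQUIVALENT to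

  (HM)  the Hodge conjecture in the MIDDLE degree: every rational `(p,p)`-class on every smooth projective
        complex variety of dimension `2p` is algebraic

(`sectionalSource_iff_hodgeMiddle`). Both directions are THICK-free (no `ThickDescent`):

* SS ⇒ (HM) (`hodge_middle_of_sectionalSource`): the product trick `X := X₀ × ℙ¹`, `c := pr₁^* c₀`, SS at
  `(2p+1, p)` forcing ONE affine complement piece, dominance of such sections over `X₀` and the degree trick
  `g_* g^* = deg g • id` — now the tree theorem
  `Literature.AlgebraicGeometry.HodgeTheory.mem_algebraicClasses_middle_of_affineComplSections`
  (file `Literature/AlgebraicGeometry/HodgeTheory/MiddleHodgeOfAffineComplementSections.lean`, p152704, with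
  its geometric lemmas `surjective_comp_fst_of_isAffineOpen_compl`, `eq_of_isClosedImmersion_of_surjective`).
* (HM) ⇒ SS (`sectionalSource_of_hodgeMiddle`): for `p ≤ 1` the landed calibration `stub_lowDegree` (fed
  with the landed `stub_supply`); for `p ≥ 2` cut `X` by `k = n − 2p` hyperplane sections of ONE embedding to
  a smooth `Y` of dimension exactly `2p` whose complement is `≤ k` ambient basic affine opens (the landed
  `stub_iteratedSupply`, p153594), note that `f^* c` is a rational `(p,p)`-class in the MIDDLE degree of `Y`
  (`IsRationalClass.map`, `IsOfHodgeType.map_of_le`) and apply (HM) on `Y`. This is the composition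
  `SectionalSource_of` of the line's skeleton `Lines/birth.lean` (reshape 3), restated here against (HM).

Consequences recorded: `hodge_fourfold_of_sectionalSource` (SS ⇒ every rational `(2,2)`-class on every smooth
projective fourfold is algebraic), `not_sectionalSource_of_middle_counterexample` (ONE non-algebraic
middle-degree Hodge class refutes SS — kill criterion, THICK-free), and `sectionalSource_iff_hodgeMiddle_two_le`
(the equivalence with (HM) restricted to `p ≥ 2`, the cases `p ≤ 1` being Lefschetz `(1,1)` /
`algebraicClasses_zero`). Reading for the route: HC ⟸ THICK ∧ SS was the bet; SS is exactly middle-degree HC,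
so the route reads HC ⟸ (THICK below the middle) ∧ (HC in the middle degree), and the crux's open content at
its first slice `(n, p) = (5, 2)` is HC for fourfolds in degree 4.

## References

* C. Voisin, *Hodge Theory and Complex Algebraic Geometry I* (2002), §7.3.2 Remark 7.29, Thm. 11.30. [VoisinHodgeI2002]
* C. Voisin, *Hodge Theory and Complex Algebraic Geometry II* (2003), §1.2.2 Thm. 1.23, §2.1.1. [VoisinHodgeII2003]
* P. Deligne, *The Hodge conjecture*, Clay Mathematics Institute (2000), §1. [Deligne2000]
* R. Hartshorne, *Algebraic Geometry* (1977), II Prop. 2.5, II Ex. 4.5, II Thm. 8.18. [Hartshorne1977]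
-/

noncomputable section

set_option linter.dupNamespace false

open CategoryTheory AlgebraicGeometry MonoidalCategory CartesianMonoidalCategory
open Literature.AlgebraicGeometry Literature.AlgebraicGeometry.Motives Literature.AlgebraicGeometry.HodgeTheory
open Summit.HodgeConjecture.HodgeConjecture.Theses.AmpleAdicLefschetz

namespace Summit.HodgeConjecture.HodgeConjecture.Cruxes.SectionalSource.Hardness

/-! ## SS ⇒ middle-degree HC -/

/-- **SS alone implies the Hodge conjecture in the middle degree** (THICK-free): granted the crux
`SectionalSource`, every rational `(p,p)`-class on every smooth projective complex variety of dimension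
`2p` is algebraic — the tree theorem `mem_algebraicClasses_middle_of_affineComplSections` fed with SS at the
slice `(n, p) = (2p + 1, p)`. [cite: VoisinHodgeI2002, §7.3.2 Remark 7.29] [cite: Deligne2000, §1] -/
theorem hodge_middle_of_sectionalSource (hSS : SectionalSource) ⦃p : ℕ⦄ ⦃X0 : SchemeOver ℂ⦄
    (hX0 : IsSmoothProjective (2 * p) X0) (c0 : complexBetti X0 (2 * p)) (hc : IsRationalClass c0)
    (hh : IsOfHodgeType (2 * p) X0 (2 * p) p p c0) : c0 ∈ algebraicClasses X0 p :=
  mem_algebraicClasses_middle_of_affineComplSections (fun _ hX c hc' hh' => hSS hX le_rfl c hc' hh')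
    hX0 c0 hc hh

/-- **SS implies the Hodge conjecture for `(2,2)`-classes on every smooth projective FOURFOLD** — the
first open case of the Hodge conjecture — THICK-free (`p = 2` in `hodge_middle_of_sectionalSource`).
[cite: Deligne2000, §1] [cite: VoisinHodgeI2002, §7.3.2 Remark 7.29] -/
theorem hodge_fourfold_of_sectionalSource (hSS : SectionalSource) ⦃X : SchemeOver ℂ⦄
    (hX : IsSmoothProjective 4 X) (c : complexBetti X 4) (hc : IsRationalClass c)
    (hh : IsOfHodgeType 4 X 4 2 2 c) : c ∈ algebraicClasses X 2 :=
  hodge_middle_of_sectionalSource hSS (p := 2) hX c hc hh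

/-- **Kill-criterion form**: a single rational `(p,p)`-class on a smooth projective `2p`-fold that is NOT
algebraic (a counterexample to the Hodge conjecture in the middle degree) refutes the crux
`SectionalSource` outright — no `ThickDescent` involved. [cite: Deligne2000, §1] -/
theorem not_sectionalSource_of_middle_counterexample
    (h : ∃ (p : ℕ) (X0 : SchemeOver ℂ) (c0 : complexBetti X0 (2 * p)), IsSmoothProjective (2 * p) X0 ∧
      IsRationalClass c0 ∧ IsOfHodgeType (2 * p) X0 (2 * p) p p c0 ∧ c0 ∉ algebraicClasses X0 p) :
    ¬ SectionalSource := by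
  rintro hSS
  obtain ⟨p, X0, c0, hX0, hc, hh, hnot⟩ := h
  exact hnot (hodge_middle_of_sectionalSource hSS hX0 c0 hc hh)

/-! ## Middle-degree HC ⇒ SS (the line's composition, against (HM)) -/

/-- **The Hodge conjecture in the middle degree implies the crux `SectionalSource`** (THICK-free): for
`p ≤ 1` by the landed calibration `stub_lowDegree` fed with the landed `stub_supply`; for `p ≥ 2`, cut the
`n`-fold `X` by `k = n − 2p` hyperplane sections of one projective embedding to a smooth projective `Y` of
dimension exactly `2p` whose non-empty complement is covered by `≤ k` affine (ambient basic) opens — the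
landed `stub_iteratedSupply` — so that `2p + |s| ≤ n`; the class `f^* c` is rational (`IsRationalClass.map`)
and of Hodge type `(p,p)` on `Y` (`IsOfHodgeType.map_of_le`, `2p ≤ n`, a Hodge model of `Y` by
`nonempty_hodgeModel_holds`), a class in the MIDDLE degree of `Y`, hence algebraic by the hypothesis.
[cite: Deligne2000, §1] [cite: VoisinHodgeI2002, §7.3.2] [cite: Hartshorne1977, II Thm. 8.18 and II Prop. 2.5] -/
theorem sectionalSource_of_hodgeMiddle
    (hMid : ∀ ⦃p : ℕ⦄ ⦃X₀ : SchemeOver ℂ⦄, IsSmoothProjective (2 * p) X₀ →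
      ∀ c₀ : complexBetti X₀ (2 * p), IsRationalClass c₀ → IsOfHodgeType (2 * p) X₀ (2 * p) p p c₀ →
        c₀ ∈ algebraicClasses X₀ p) :
    SectionalSource := by
  intro n p X hX hp c hc hh
  by_cases hlow : p ≤ 1 ∨ n ≤ 4
  · exact Summit.HodgeConjecture.HodgeConjecture.Theorems.stub_lowDegree
      Summit.HodgeConjecture.HodgeConjecture.Theorems.stub_supply hX hp hlow c hc hh
  · obtain ⟨Y, f, s, hY, hf, hs, hcov, hcard, hne⟩ :=
      Summit.HodgeConjecture.HodgeConjecture.Theorems.stub_iteratedSupply hX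
        (show 1 ≤ n - 2 * p by omega) (show n - 2 * p + 1 ≤ n by omega)
    have hdim : n - (n - 2 * p) = 2 * p := by omega
    rw [hdim] at hY
    haveI := hf
    refine ⟨2 * p, Y, f, s, hY, hf, hs, hcov, by omega, hne, ?_⟩
    obtain ⟨B⟩ := (nonempty_hodgeModel_holds (n := 2 * p) (X := Y)) hY
    have hrat : IsRationalClass (complexBetti.map f (2 * p) c) :=
      hc.map (AlgPoints.mapContinuous (L := ℂ) f)
    have hhdg : IsOfHodgeType (2 * p) Y (2 * p) p p (complexBetti.map f (2 * p) c) :=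
      hh.map_of_le hY hX B f (by omega)
    exact hMid hY _ hrat hhdg

/-! ## The characterisation -/

/-- **`SectionalSource` ⟺ the Hodge conjecture in the middle degree.** The crux of the route
`AmpleAdicLefschetz` is EQUIVALENT to: every rational `(p,p)`-class on every smooth projective complex
variety of dimension `2p` is algebraic (`hodge_middle_of_sectionalSource`, `sectionalSource_of_hodgeMiddle`).
Unconditional, `ThickDescent`-free, sorry-free. [cite: Deligne2000, §1] [cite: VoisinHodgeI2002, §7.3.2 Remark 7.29] -/
theorem sectionalSource_iff_hodgeMiddle :
    SectionalSource ↔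
      ∀ ⦃p : ℕ⦄ ⦃X₀ : SchemeOver ℂ⦄, IsSmoothProjective (2 * p) X₀ →
        ∀ c₀ : complexBetti X₀ (2 * p), IsRationalClass c₀ → IsOfHodgeType (2 * p) X₀ (2 * p) p p c₀ →
          c₀ ∈ algebraicClasses X₀ p :=
  ⟨fun h _ _ hX₀ c₀ hc hh => hodge_middle_of_sectionalSource h hX₀ c₀ hc hh, sectionalSource_of_hodgeMiddle⟩

/-- **The cases `p ≤ 1` of middle-degree HC are theorems** (`p = 0`: `algebraicClasses_zero`; `p = 1`:
Lefschetz `(1,1)` on surfaces, `lefschetzOneOne_rational_holds`), so the crux is equivalent to middle-degree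
HC for `p ≥ 2` — exactly the open stub `stub_hodgeMiddle` of the line's skeleton (`Lines/birth.lean`,
reshape 3), whose first instance is HC for fourfolds in degree 4. [cite: VoisinHodgeI2002, Thm. 11.30]
[cite: Deligne2000, §1] -/
theorem sectionalSource_iff_hodgeMiddle_two_le :
    SectionalSource ↔
      ∀ ⦃p : ℕ⦄ ⦃X₀ : SchemeOver ℂ⦄, IsSmoothProjective (2 * p) X₀ → 2 ≤ p →
        ∀ c₀ : complexBetti X₀ (2 * p), IsRationalClass c₀ → IsOfHodgeType (2 * p) X₀ (2 * p) p p c₀ →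
          c₀ ∈ algebraicClasses X₀ p := by
  refine ⟨fun h _ _ hX₀ _ c₀ hc hh => hodge_middle_of_sectionalSource h hX₀ c₀ hc hh, fun hMid => ?_⟩
  refine sectionalSource_of_hodgeMiddle fun p X₀ hX₀ c₀ hc hh => ?_
  rcases Nat.lt_or_ge p 2 with hp | hp
  · interval_cases p
    · rw [algebraicClasses_zero]
      trivial
    · exact lefschetzOneOne_rational_holds hX₀ _ hc hh
  · exact hMid hX₀ hp c₀ hc hh

end Summit.HodgeConjecture.HodgeConjecture.Cruxes.SectionalSource.Hardness

end
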